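import Literature.AlgebraicGeometry.AbelianVarieties.FourierMukaiTransformPlus
import Literature.AlgebraicGeometry.Modules.DerivedPushforwardIsoBaseChange
import Literature.AlgebraicGeometry.Modules.DetClassDual
import HarnessLib

/-!
# Markman's functor `Φ = (id × Ψ_{𝒫⁻¹}) ∘ μ^* : D⁺(Mod 𝒪_{A×A}) ⥤ D⁺(Mod 𝒪_{A×Â})` of a principally polarised abelian
# variety: the shear `μ(x₁, x₂) = (x₁x₂, x₂)` and the RELATIVE integral transform along the second factor
# (Markman 2025, §6 eq. (Phi) p. 26; Mukai 1981 §1)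

Layer `Literature/AlgebraicGeometry/AbelianVarieties`. Markman [§6, p. 26 L34–51]: "Let `μ : X × X → X × X` be given by
`(x₁, x₂) = (x₁ + x₂, x₂)`. Let `id × Φ_𝒫 : D^b(X × X̂) → D^b(X × X)` be the integral transform with kernel `𝒪_Δ ⊠ 𝒫` … The
inverse `Φ := (id × Ψ_{𝒫⁻¹[n]}) ∘ μ^* : D^b(X × X) → D^b(X × X̂)`", with `Ψ_F(•) := Rπ_{X,*}(F ⊗ Lπ_Y^*(•))` [§5 p. 24 L20–23].
With the tree's Fourier machinery on `D⁺` of ALL `𝒪`-modules (`AbelianVarieties/FourierMukaiTransformPlus.integralTransformPlus`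
along a span, `Modules/DerivedPushforward`) this file TYPES Markman's functor for a PRINCIPAL polarisation (`𝒫` of
`PoincareSheafOfPrincipal`, `𝒫⁻¹ = 𝒫^∨ = Modules.dual 𝒫`), 0 named facts, no instances:

* §1 the SHEAR automorphism **`shearIso A : A.X ⊗ A.X ≅ A.X ⊗ A.X`**, `μ = (m, p₂)` with inverse `(x₁x₂⁻¹, x₂)` (group-object
  algebra in `Hom(A × A, A)`), `shear_hom_comp_fst = fst * snd` (`= m`), `shear_hom_comp_snd = snd`, and its scheme form.
* §2 for abelian varieties `A`, `B`, `C` and a kernel `K` on `B × C`: the RELATIVE integral transform along the second factor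
  **`relativeIntegralTransformPlus A B C K : D⁺(Mod 𝒪_{A×B}) ⥤ D⁺(Mod 𝒪_{A×C})`** = `id_A × Ψ_K`, the integral transform along the
  span `A×B ⟵pr₁₂ (A×B)×C ⟶pr₁₃ A×C` with kernel `pr₂₃^*K` (exact kernel functor: `pr₁₂` flat, `pr₂₃^*K` a line bundle) and its
  `CommShift ℤ`.
* §3 **`markmanPhiPlus A hΘ hK := D⁺(μ^*) ⋙ (id × Ψ_{𝒫^∨}) : D⁺(Mod 𝒪_{A×A}) ⥤ D⁺(Mod 𝒪_{A×Â})`** and `commShiftMarkmanPhiPlus`.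
  Print's `Φ` carries the extra SHIFT `[n]` (`n = dim A`) in the kernel `𝒫⁻¹[n]`; it is omitted here (a shift of the target,
  to be re-attached by the consumer: `markmanPhiPlus ⋙ shiftFunctor _ n`), as is print's twist `[Θ ⊠ Θ] ⊗` of §9.2 (`Φ̃`).

NOT asserted: that `markmanPhiPlus` is an equivalence ∕ full ∕ faithful (Mukai–Orlov; print cites Huybrechts), its values on box
products (Markman Lemma 6.x), nor anything on `D^b(Coh)`. Typed for the cell `pub-hodge-ring2` (plate P2 of the (M1) library debt of
crux 26512: the `Φ`-binder B10 of the sockets `Theorems/VHCAbelianSchemesRoadOneNonJumpingPointOfInputsPlus(Pairwise)` is meant to be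
instantiated at `markmanPhiPlus J …` (up to shift and twist) once (1d) is priced); a research route conditional on HC_CM, not a
corollary — nothing in this file refers to it.

## References

* E. Markman, *Cycles on abelian 2n-folds of Weil type from secant sheaves on abelian n-folds*, arXiv:2502.03415 (2025), §5 p. 24
  L10–23 (`Φ_F`, `Ψ_F`), §6 p. 26 L34–51 (`μ`, `id × Φ_𝒫`, `Φ := (id × Ψ_{𝒫⁻¹[n]}) ∘ μ^*`). [Markman2025SecantWeil]
* S. Mukai, *Duality between `D(X)` and `D(X̂)`…*, Nagoya Math. J. 81 (1981), §1 (1.1). [Mukai1981]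
* D. Huybrechts, *Fourier–Mukai transforms in algebraic geometry* (2006), Def. 5.1, §9. [HuybrechtsFM2006]
-/

noncomputable section

-- `TopCat.Presheaf`/`Scheme.Modules` are not reducible (as in Mathlib's `AlgebraicGeometry/Modules/Sheaf.lean`).
set_option backward.isDefEq.respectTransparency false

open CategoryTheory CategoryTheory.Limits AlgebraicGeometry MonoidalCategory CartesianMonoidalCategory
open AlgebraicGeometry.Scheme.Modules

universe w₁ w₂ w₃ u

namespace Literature.AlgebraicGeometry.AbelianVarieties

open Literature.AlgebraicGeometry.Motives Literature.AlgebraicGeometry.Modules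
open scoped MonObj

/-! ### §1 The shear automorphism `μ(x₁, x₂) = (x₁x₂, x₂)` of `A × A` -/

section Shear

variable {K : Type u} [Field K] (A : AbelianVariety K)

/-- **The shear `μ : A × A ⥲ A × A`, `(x₁, x₂) ↦ (x₁x₂, x₂)`** ("`μ(x₁, x₂) = (x₁ + x₂, x₂)`"), an automorphism of `K`-schemes with
inverse `(x₁, x₂) ↦ (x₁x₂⁻¹, x₂)` — in the group `Hom(A × A, A)` of the group object `A.X`: `μ = (fst * snd, snd)`.
[cite: Markman2025SecantWeil, §6 p. 26 L34 (definition of μ)] -/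
def shearIso : A.X ⊗ A.X ≅ A.X ⊗ A.X where
  hom := lift (fst A.X A.X * snd A.X A.X) (snd A.X A.X)
  inv := lift (fst A.X A.X * (snd A.X A.X)⁻¹) (snd A.X A.X)
  hom_inv_id := by
    ext
    · rw [Category.assoc, lift_fst, MonObj.comp_mul, lift_fst, GrpObj.comp_inv, lift_snd, mul_inv_cancel_right,
        Category.id_comp]
    · rw [Category.assoc, lift_snd, lift_snd, Category.id_comp]
  inv_hom_id := by
    ext
    · rw [Category.assoc, lift_fst, MonObj.comp_mul, lift_fst, lift_snd, inv_mul_cancel_right, Category.id_comp]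
    · rw [Category.assoc, lift_snd, lift_snd, Category.id_comp]

/-- `μ ≫ p₁ = p₁ * p₂` (the group law `m`). [cite: Markman2025SecantWeil, §6 p. 26 L34] -/
@[simp]
theorem shearIso_hom_comp_fst : (shearIso A).hom ≫ fst A.X A.X = fst A.X A.X * snd A.X A.X := lift_fst _ _

/-- `μ ≫ p₂ = p₂`. [cite: Markman2025SecantWeil, §6 p. 26 L34] -/
@[simp]
theorem shearIso_hom_comp_snd : (shearIso A).hom ≫ snd A.X A.X = snd A.X A.X := lift_snd _ _

/-- `μ⁻¹ ≫ p₂ = p₂`. [cite: Markman2025SecantWeil, §6 p. 26 L34] -/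
@[simp]
theorem shearIso_inv_comp_snd : (shearIso A).inv ≫ snd A.X A.X = snd A.X A.X := lift_snd _ _

/-- The shear as an isomorphism of the underlying schemes. [cite: Markman2025SecantWeil, §6 p. 26 L34] -/
def shearSchemeIso : (A.X ⊗ A.X).left ≅ (A.X ⊗ A.X).left :=
  (Over.forget _).mapIso (shearIso A)

/-- `μ^*` is left exact (pull-back along an isomorphism). [cite: Hartshorne1977, II §5 p. 110] -/
theorem preservesFiniteLimits_pullback_shear : PreservesFiniteLimits (Scheme.Modules.pullback (shearSchemeIso A).hom) :=
  preservesFiniteLimits_pullback_of_iso _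

end Shear

/-! ### §2 The relative integral transform `id_A × Ψ_K : D⁺(Mod 𝒪_{A×B}) ⥤ D⁺(Mod 𝒪_{A×C})` along the second factor -/

section Relative

variable (A B C : AbelianVariety ℂ) (K : (B.X ⊗ C.X).left.Modules) (hK : IsFiniteLocallyFree K) (hK₁ : HasRank K 1)

/-- `pr₁₂ : (A × B) × C → A × B`. [cite: Markman2025SecantWeil, §5 p. 24 L20–23 (π_X, π_Y)] -/
abbrev pr₁₂ : (A.X ⊗ B.X) ⊗ C.X ⟶ A.X ⊗ B.X := fst _ _

/-- `pr₁₃ : (A × B) × C → A × C`. [cite: Markman2025SecantWeil, §5 p. 24 L20–23] -/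
abbrev pr₁₃ : (A.X ⊗ B.X) ⊗ C.X ⟶ A.X ⊗ C.X := lift (fst _ _ ≫ fst _ _) (snd _ _)

/-- `pr₂₃ : (A × B) × C → B × C`. [cite: Markman2025SecantWeil, §5 p. 24 L20–23] -/
abbrev pr₂₃ : (A.X ⊗ B.X) ⊗ C.X ⟶ B.X ⊗ C.X := lift (fst _ _ ≫ snd _ _) (snd _ _)

/-- `pr₁₂^*` is exact: `pr₁₂ = fst` is flat (base change of `C → Spec ℂ`). [cite: Hartshorne1977, III Prop. 9.2 (b)] -/
theorem preservesFiniteLimits_pullback_pr₁₂ :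
    PreservesFiniteLimits (Scheme.Modules.pullback (pr₁₂ A B C).left) :=
  haveI : Flat (pr₁₂ A B C).left := Literature.AlgebraicGeometry.HodgeTheory.fst_left_flat _ _
  preservesFiniteLimits_pullback_of_flat _

include hK hK₁ in
/-- `pr₂₃^*K ⊗ –` is left exact for `K` a line bundle. [cite: StacksProject, Tag 0B8M] -/
theorem preservesFiniteLimits_tensor_pullback_pr₂₃ :
    PreservesFiniteLimits ((tensorBifunctor ((A.X ⊗ B.X) ⊗ C.X).left).obj
      ((Scheme.Modules.pullback (pr₂₃ A B C).left).obj K)) :=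
  (isInvertibleModule_of_hasRank_one (hK.pullback _) (hasRank_pullback _ hK₁)).preservesFiniteLimits

include hK hK₁ in
/-- `pr₂₃^*K ⊗ –` is right exact for `K` a line bundle. [cite: StacksProject, Tag 0B8M] -/
theorem preservesFiniteColimits_tensor_pullback_pr₂₃ :
    PreservesFiniteColimits ((tensorBifunctor ((A.X ⊗ B.X) ⊗ C.X).left).obj
      ((Scheme.Modules.pullback (pr₂₃ A B C).left).obj K)) :=
  (isInvertibleModule_of_hasRank_one (hK.pullback _) (hasRank_pullback _ hK₁)).preservesFiniteColimits

variable [HasDerivedCategory.{w₁} (A.X ⊗ B.X).left.Modules] [HasDerivedCategory.{w₂} ((A.X ⊗ B.X) ⊗ C.X).left.Modules]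
  [HasDerivedCategory.{w₃} (A.X ⊗ C.X).left.Modules]

/-- **The relative integral transform `id_A × Ψ_K : D⁺(Mod 𝒪_{A×B}) ⥤ D⁺(Mod 𝒪_{A×C})`** with kernel a LINE BUNDLE `K` on `B × C`:
`E• ↦ R(pr₁₃)_*(pr₂₃^*K ⊗ pr₁₂^*E•)`, the integral transform along the span `A×B ⟵ (A×B)×C ⟶ A×C` with kernel `pr₂₃^*K`
("the integral transform with kernel `𝒪_Δ ⊠ K`"). [cite: Markman2025SecantWeil, §6 p. 26 L35–36 (id × Φ_𝒫, kernel 𝒪_Δ ⊠ 𝒫)]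
[cite: Markman2025SecantWeil, §5 p. 24 L20–23 (Ψ_F)] -/
def relativeIntegralTransformPlus :
    DerivedCategory.Plus (A.X ⊗ B.X).left.Modules ⥤ DerivedCategory.Plus (A.X ⊗ C.X).left.Modules :=
  haveI := preservesFiniteLimits_pullback_pr₁₂ A B C
  haveI := preservesFiniteLimits_tensor_pullback_pr₂₃ A B C K hK hK₁
  haveI := preservesFiniteColimits_tensor_pullback_pr₂₃ A B C K hK hK₁
  integralTransformPlus (pr₁₂ A B C).left (pr₁₃ A B C).left ((Scheme.Modules.pullback (pr₂₃ A B C).left).obj K)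

/-- `id_A × Ψ_K` commutes with the shifts. A `def`, not an instance (bind with `letI`). [cite: Markman2025SecantWeil, §5 p. 24 L20–23] -/
@[implicit_reducible]
def commShiftRelativeIntegralTransformPlus : (relativeIntegralTransformPlus A B C K hK hK₁).CommShift ℤ :=
  haveI := preservesFiniteLimits_pullback_pr₁₂ A B C
  haveI := preservesFiniteLimits_tensor_pullback_pr₂₃ A B C K hK hK₁
  haveI := preservesFiniteColimits_tensor_pullback_pr₂₃ A B C K hK hK₁
  commShiftIntegralTransformPlus _ _ _

end Relative

/-! ### §3 Markman's `Φ = (id × Ψ_{𝒫⁻¹}) ∘ μ^*` for a principal polarisation -/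

section Markman

variable (A : AbelianVariety ℂ) {Θ : CartierDivisor A.X.left} (hΘ : Θ.IsAmple) (hK : A.KTheta Θ = ⊥)
  [HasDerivedCategory.{w₁} (A.X ⊗ A.X).left.Modules]
  [HasDerivedCategory.{w₂} ((A.X ⊗ A.X) ⊗ (A.dualOf Θ hΘ).X).left.Modules]
  [HasDerivedCategory.{w₃} (A.X ⊗ (A.dualOf Θ hΘ).X).left.Modules]

/-- **Markman's functor `Φ = (id × Ψ_{𝒫⁻¹}) ∘ μ^* : D⁺(Mod 𝒪_{A×A}) ⥤ D⁺(Mod 𝒪_{A×Â})`** for a principal polarisation `Θ`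
(`𝒫⁻¹ = 𝒫^∨ = Modules.dual 𝒫`, a line bundle): pull back along the shear `μ`, then the relative transform with kernel `𝒫^∨`
along the second factor. Print's kernel is `𝒫⁻¹[n]`, `n = dim A`: the SHIFT `[n]` is omitted here (re-attach as
`⋙ shiftFunctor _ n`), and so is the twist `[Θ ⊠ Θ] ⊗` of print's `Φ̃` (§9.2). Equivalence ∕ fullness NOT asserted.
[cite: Markman2025SecantWeil, §6 p. 26 L44–51 (Φ := (id × Ψ_{𝒫⁻¹[n]}) ∘ μ^*)] [cite: HuybrechtsFM2006, §9 (Prop. 9.19)] -/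
def markmanPhiPlus :
    DerivedCategory.Plus (A.X ⊗ A.X).left.Modules ⥤ DerivedCategory.Plus (A.X ⊗ (A.dualOf Θ hΘ).X).left.Modules :=
  haveI := preservesFiniteLimits_pullback_shear A
  (Scheme.Modules.pullback (shearSchemeIso A).hom).mapDerivedCategoryPlus ⋙
    relativeIntegralTransformPlus A A (A.dualOf Θ hΘ) (Modules.dual (poincareSheaf A hΘ hK))
      (isFiniteLocallyFree_dual (isFiniteLocallyFree_poincareSheaf A hΘ hK)) (hasRank_dual (hasRank_poincareSheaf A hΘ hK))

/-- Unfolding of `markmanPhiPlus`. [cite: Markman2025SecantWeil, §6 p. 26 L44–51] -/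
theorem markmanPhiPlus_def :
    markmanPhiPlus A hΘ hK =
      (haveI := preservesFiniteLimits_pullback_shear A
       (Scheme.Modules.pullback (shearSchemeIso A).hom).mapDerivedCategoryPlus ⋙
        relativeIntegralTransformPlus A A (A.dualOf Θ hΘ) (Modules.dual (poincareSheaf A hΘ hK))
          (isFiniteLocallyFree_dual (isFiniteLocallyFree_poincareSheaf A hΘ hK))
          (hasRank_dual (hasRank_poincareSheaf A hΘ hK))) := rfl

/-- Markman's `Φ` commutes with the shifts. A `def`, not an instance (bind with `letI`).
[cite: Markman2025SecantWeil, §6 p. 26 L44–51] -/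
@[implicit_reducible]
def commShiftMarkmanPhiPlus : (markmanPhiPlus A hΘ hK).CommShift ℤ := by
  haveI := preservesFiniteLimits_pullback_shear A
  letI := (Scheme.Modules.pullback (shearSchemeIso A).hom).commShiftMapDerivedCategoryPlus
    (C := (A.X ⊗ A.X).left.Modules) (D := (A.X ⊗ A.X).left.Modules)
  letI := commShiftRelativeIntegralTransformPlus A A (A.dualOf Θ hΘ) (Modules.dual (poincareSheaf A hΘ hK))
    (isFiniteLocallyFree_dual (isFiniteLocallyFree_poincareSheaf A hΘ hK)) (hasRank_dual (hasRank_poincareSheaf A hΘ hK))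
  exact (inferInstance : ((Scheme.Modules.pullback (shearSchemeIso A).hom).mapDerivedCategoryPlus ⋙
    relativeIntegralTransformPlus A A (A.dualOf Θ hΘ) (Modules.dual (poincareSheaf A hΘ hK))
      (isFiniteLocallyFree_dual (isFiniteLocallyFree_poincareSheaf A hΘ hK))
      (hasRank_dual (hasRank_poincareSheaf A hΘ hK))).CommShift ℤ)

end Markman

end Literature.AlgebraicGeometry.AbelianVarieties

end
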